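import Literature.AlgebraicGeometry.HodgeTheory.MonomialSupportedLinearPencil
import Literature.AlgebraicGeometry.HodgeTheory.MonodromyGroupBaseChange
import Literature.AlgebraicGeometry.HodgeTheory.CyclicCoverLinearPencilLoops
import Literature.AlgebraicGeometry.FundamentalGroup.HypersurfaceComplementZariskiPencils
import HarnessLib

/-!
# Every loop of the base of the `M`-supported family lifts, up to homotopy, to a transversal pencil (Zariski's
# theorem for the pencils `f₀ + u·g` of `M`-supported hypersurfaces)

Family `hodge`, layer `Literature/AlgebraicGeometry/HodgeTheory`, namespace `…HodgeTheory.MonomialPencil`; theorems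
only, no named fact. Written by the prover seat `hodge-nonav-prover-Ax` (g15, cell `hodge-nonav`) for route
`SignSymmetricPowers` (crux K1-B, stmt-HodgeConjecture-19716), programme PENCIL-B (brick «F-mono», part 2); the
companion of `CyclicCoverLinearPencilLoops` (route `CyclicUnitaryPowers`) for the base `S_M` of `familyM ℂ n d M`.

For the pencil `ι = pencilMap : P ⟶ S_M` (file `MonomialSupportedLinearPencil`), a coefficient chart
`χ : S_M(ℂ) ≃ₜ ℂ^M ∖ V(h)` reading the `M`-coefficients of the forms of points (for the route: `h` a reduced
equation of the restricted discriminant, chart `SignSymmetricPowersMeridianChart.isEmbedding_coeffChart`), and a point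
`c₀ ∈ P(ℂ)` whose pointed line `(f₀ + u₀ g, g)` has `pencilDiscr h ≠ 0`, EVERY loop of `S_M(ℂ)` at `ι c₀` is homotopic
with fixed base point to the image under `ι` of a loop of `P(ℂ)` at `c₀` (`exists_loop_lift_pencilMap`): Zariski's
theorem `HypersurfaceComplementZariskiPencils.exists_loop_in_line_of_pencilDiscr` read through `χ` and the chart
`P(ℂ) ≃ₜ range (pencilCoord)` (`isEmbedding_pencilCoord`, `exists_pencilCoord_eq_of_coeff`); the path-class transport lemma is
route A's `LinearPencil.mk_eq_mk_of_comp`.  This is exactly the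
hypothesis of `MonodromyGroupBaseChange.exists_finiteIndex_conj_mem_ratMonodromyGroup_familyPullback`, whence the
large-monodromy input (HL) of the pencil (`exists_finiteIndex_pencilMap`).

## References

* [Dimca1992] A. Dimca, *Singularities and Topology of Hypersurfaces* (1992), Ch. 4 §3 Prop. (3.1).
* [VoisinHodgeII2003] C. Voisin, *Hodge Theory and Complex Algebraic Geometry II*, §3.1.2, §3.2.2 Thm. 3.22, §6.2.1.
* [HatcherAT2002] A. Hatcher, *Algebraic Topology*, §1.1 (change of base point, induced maps).
-/

noncomputable section

namespace Literature.AlgebraicGeometry.HodgeTheory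

open CategoryTheory MvPolynomial _root_.Topology Set unitInterval
open Literature.AlgebraicGeometry.Motives Literature.AlgebraicGeometry.Motives.UniversalHypersurface
open Literature.AlgebraicGeometry.Motives.SmoothHypersurface (IsNonsingularForm)
open Literature.AlgebraicGeometry.HodgeTheory.UniversalHypersurface
open Literature.AlgebraicGeometry.FundamentalGroup Literature.AlgebraicTopology.FundamentalGroup

namespace MonomialPencil

/-! ### Loops of `S_M(ℂ)` lift to transversal pencils -/

section Lift

variable {n d : ℕ} {M : Set (DegIndex n d)} [Fintype M] {f₀ g : M → ℂ}

/-- **Every loop of `S_M(ℂ)` at a point of a transversal pencil is homotopic to a loop in the pencil** (Zariski's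
theorem, Dimca Ch. 4 Prop. (3.1), read through a coefficient chart).  Data: a chart `χ : S_M(ℂ) ≃ₜ ℂ^M ∖ V(h)` reading
the `M`-coefficients of the forms of points (`hχ`), `g ≠ 0`, a point `c₀` of the pencil base with coordinate `u₀`, and
`pencilDiscr h (f₀ + u₀ g, g) ≠ 0`.  Then every loop `γ` of `S_M(ℂ)` at `ι c₀` satisfies `⟦γ⟧ = ⟦ι ∘ δ⟧` for a loop `δ`
of `P(ℂ)` at `c₀`. [cite: Dimca1992, Ch. 4 §3 Prop. (3.1)] [cite: VoisinHodgeII2003, §3.2.2 Thm. 3.22] -/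
theorem exists_loop_lift_pencilMap {h : MvPolynomial M ℂ}
    (χ : ComplexPoints (baseM ℂ n d M) ≃ₜ affineHypersurfaceComplement ![h])
    (hχ : ∀ (t : ComplexPoints (baseM ℂ n d M)) (m : M), (χ t : M → ℂ) m = coeff m.1.1 (pointFormM ℂ n d M t))
    (hg : g ≠ 0) (c₀ : ComplexPoints (pencilBase n d M f₀ g))
    (hQ : MvPolynomial.eval (Sum.elim (f₀ + pencilCoord n d M f₀ g c₀ • g) g) (pencilDiscr h) ≠ 0)
    (γ : Path (baseMapUniv (pencilMap n d M f₀ g) ⟨c₀, mem_univ _⟩) (baseMapUniv (pencilMap n d M f₀ g) ⟨c₀, mem_univ _⟩)) :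
    ∃ δ : Path (⟨c₀, mem_univ _⟩ : (univ : Set (ComplexPoints (pencilBase n d M f₀ g)))) ⟨c₀, mem_univ _⟩,
      Path.Homotopic.Quotient.mk γ = Path.Homotopic.Quotient.mk (δ.map (baseMapUniv (pencilMap n d M f₀ g)).continuous) := by
  have hbU : f₀ + pencilCoord n d M f₀ g c₀ • g ∈ affineHypersurfaceComplement ![h] :=
    mem_affineHypersurfaceComplement_of_pencilDiscr hQ
  have hbe : ∀ m, (f₀ + pencilCoord n d M f₀ g c₀ • g) m = f₀ m + pencilCoord n d M f₀ g c₀ * g m := fun m => rfl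
  -- the base point in the chart
  have hχc₀ : χ (AlgPoints.map (pencilMap n d M f₀ g) c₀) = ⟨f₀ + pencilCoord n d M f₀ g c₀ • g, hbU⟩ :=
    Subtype.ext (funext fun m => by rw [hχ, coeff_pointFormM_map_pencilMap_of_mem n d M f₀ g c₀ m.2]; exact (hbe m).symm)
  -- the chart maps between `S_M(ℂ)` (as `univ`) and `ℂ^M ∖ V(h)`
  let Φ : C((univ : Set (ComplexPoints (baseM ℂ n d M))), affineHypersurfaceComplement ![h]) :=
    ⟨fun x => χ x.1, χ.continuous.comp continuous_subtype_val⟩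
  let Ψ : C(affineHypersurfaceComplement ![h], (univ : Set (ComplexPoints (baseM ℂ n d M)))) :=
    ⟨fun a => ⟨χ.symm a, mem_univ _⟩, χ.symm.continuous.subtype_mk _⟩
  have hΦ0 : Φ (baseMapUniv (pencilMap n d M f₀ g) ⟨c₀, mem_univ _⟩) = ⟨f₀ + pencilCoord n d M f₀ g c₀ • g, hbU⟩ := hχc₀
  -- Zariski's theorem for the loop read in the chart
  let γ₁ : Path (⟨f₀ + pencilCoord n d M f₀ g c₀ • g, hbU⟩ : affineHypersurfaceComplement ![h])
      ⟨f₀ + pencilCoord n d M f₀ g c₀ • g, hbU⟩ := (γ.map Φ.continuous).cast hΦ0.symm hΦ0.symm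
  obtain ⟨ω, hω⟩ := exists_loop_in_line_of_pencilDiscr hbU hQ γ₁
  -- the chart of the pencil base: `P(ℂ) ≃ₜ range (pencilCoord)`
  let κ := (isEmbedding_pencilCoord n d M f₀ hg).toHomeomorph
  have hκ : ∀ c, (κ c : ℂ) = pencilCoord n d M f₀ g c := fun c => rfl
  -- the parameters `u₀ + ω(t)` are coordinates of points of the pencil: the form of the point `χ⁻¹(b + ω(t) g)`
  -- has `M`-coefficients `f₀ + (u₀ + ω t) g`
  have hmemU : ∀ t, f₀ + pencilCoord n d M f₀ g c₀ • g + (ω t : ℂ) • g ∈ affineHypersurfaceComplement ![h] := by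
    intro t
    have h1 := (ω t).2
    simp only [LineSlice.lineSlice, mem_setOf_eq, LineSlice.linePt, add_sub_cancel_left] at h1
    exact h1
  have hrange : ∀ t, pencilCoord n d M f₀ g c₀ + (ω t : ℂ) ∈ Set.range (pencilCoord n d M f₀ g) := by
    intro t
    obtain ⟨c, hc, -⟩ := exists_pencilCoord_eq_of_coeff n d M f₀ g
      (χ.symm ⟨f₀ + pencilCoord n d M f₀ g c₀ • g + (ω t : ℂ) • g, hmemU t⟩) (pencilCoord n d M f₀ g c₀ + (ω t : ℂ))
      (fun m => by
        rw [← hχ, Homeomorph.apply_symm_apply]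
        simp only [Pi.add_apply, Pi.smul_apply, smul_eq_mul]
        ring)
    exact ⟨c, hc⟩
  -- the lifted loop
  let w : I → Set.range (pencilCoord n d M f₀ g) := fun t => ⟨pencilCoord n d M f₀ g c₀ + (ω t : ℂ), hrange t⟩
  have hw : Continuous w :=
    (continuous_const.add (continuous_subtype_val.comp ω.continuous)).subtype_mk _
  have hω0 : (ω 0 : ℂ) = 0 := congrArg Subtype.val ω.source
  have hω1 : (ω 1 : ℂ) = 0 := congrArg Subtype.val ω.target
  have hend : ∀ {t}, (ω t : ℂ) = 0 → κ.symm (w t) = c₀ := by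
    intro t ht
    have : w t = κ c₀ := Subtype.ext (by rw [hκ]; change pencilCoord n d M f₀ g c₀ + (ω t : ℂ) = _; rw [ht, add_zero])
    rw [this, Homeomorph.symm_apply_apply]
  have hcoordw : ∀ t, pencilCoord n d M f₀ g (κ.symm (w t)) = pencilCoord n d M f₀ g c₀ + (ω t : ℂ) := by
    intro t
    rw [← hκ, Homeomorph.apply_symm_apply]
  let δ : Path (⟨c₀, mem_univ _⟩ : (univ : Set (ComplexPoints (pencilBase n d M f₀ g)))) ⟨c₀, mem_univ _⟩ :=
    { toFun := fun t => ⟨κ.symm (w t), mem_univ _⟩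
      continuous_toFun := (κ.symm.continuous.comp hw).subtype_mk _
      source' := Subtype.ext (hend hω0)
      target' := Subtype.ext (hend hω1) }
  refine ⟨δ, LinearPencil.mk_eq_mk_of_comp Ψ hω γ _ (fun t => Subtype.ext ?_) (fun t => Subtype.ext ?_)⟩
  · -- `γ t = χ⁻¹ (χ (γ t))`
    change (γ t).1 = χ.symm (γ₁ t)
    rw [Path.cast_coe, Path.map_coe, Function.comp_apply]
    change (γ t).1 = χ.symm (χ (γ t).1)
    rw [Homeomorph.symm_apply_apply]
  · -- `ι (δ t) = χ⁻¹ (b + ω(t) g)`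
    change AlgPoints.map (pencilMap n d M f₀ g) (κ.symm (w t)) =
      χ.symm (((ω.map (LineSlice.lineIncl (affineHypersurfaceComplement ![h]) (f₀ + pencilCoord n d M f₀ g c₀ • g)
        (f₀ + pencilCoord n d M f₀ g c₀ • g + g)).continuous).cast
        (LineSlice.lineIncl_zero hbU (f₀ + pencilCoord n d M f₀ g c₀ • g + g)).symm
        (LineSlice.lineIncl_zero hbU (f₀ + pencilCoord n d M f₀ g c₀ • g + g)).symm) t)
    apply χ.injective
    rw [Homeomorph.apply_symm_apply, Path.cast_coe, Path.map_coe, Function.comp_apply]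
    refine Subtype.ext (funext fun m => ?_)
    rw [hχ, coeff_pointFormM_map_pencilMap_of_mem n d M f₀ g _ m.2, hcoordw, LineSlice.coe_lineIncl_apply, LineSlice.linePt]
    simp only [Pi.add_apply, Pi.smul_apply, smul_eq_mul, add_sub_cancel_left]
    ring

/-- **The large-monodromy input (HL) for a transversal pencil**: at a point `c₀` of the pencil base whose pointed
line has `pencilDiscr h ≠ 0` (for a coefficient chart `χ` onto `ℂ^M ∖ V(h)`), the whole monodromy group of the
`M`-supported family at `ι c₀` consists of `e_{c₀}`-conjugates of monodromies of the pulled-back pencil family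
(`MonodromyGroupBaseChange.exists_finiteIndex_conj_mem_ratMonodromyGroup_familyPullback`).
[cite: VoisinHodgeII2003, §3.2.2 Thm. 3.22 and §3.1.2] [cite: Dimca1992, Ch. 4 §3 Prop. (3.1)] -/
theorem exists_finiteIndex_pencilMap {h : MvPolynomial M ℂ}
    (χ : ComplexPoints (baseM ℂ n d M) ≃ₜ affineHypersurfaceComplement ![h])
    (hχ : ∀ (t : ComplexPoints (baseM ℂ n d M)) (m : M), (χ t : M → ℂ) m = coeff m.1.1 (pointFormM ℂ n d M t))
    (hg : g ≠ 0) (k : ℕ) (hU : IsCohomologicallyLocallyTrivialOn (familyM ℂ n d M) univ)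
    (hU' : IsCohomologicallyLocallyTrivialOn (familyPullback.snd (familyM ℂ n d M) (pencilMap n d M f₀ g)) univ)
    (c₀ : ComplexPoints (pencilBase n d M f₀ g))
    (hQ : MvPolynomial.eval (Sum.elim (f₀ + pencilCoord n d M f₀ g c₀ • g) g) (pencilDiscr h) ≠ 0) :
    ∃ Γ₀ : Subgroup (bettiCohomology (fiberOver (familyM ℂ n d M) (AlgPoints.map (pencilMap n d M f₀ g) c₀)) k ≃ₗ[ℚ]
        bettiCohomology (fiberOver (familyM ℂ n d M) (AlgPoints.map (pencilMap n d M f₀ g) c₀)) k),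
      Γ₀ ≤ ratMonodromyGroup (familyM ℂ n d M) k hU ⟨AlgPoints.map (pencilMap n d M f₀ g) c₀, mem_univ _⟩ ∧
      (Γ₀.subgroupOf (ratMonodromyGroup (familyM ℂ n d M) k hU ⟨AlgPoints.map (pencilMap n d M f₀ g) c₀, mem_univ _⟩)).FiniteIndex ∧
      ∀ T ∈ Γ₀, (BettiUniverse.pullEquiv (fiberOverFamilyPullbackIso (familyM ℂ n d M) (pencilMap n d M f₀ g) c₀) k).trans
          (T.trans (BettiUniverse.pullEquiv (fiberOverFamilyPullbackIso (familyM ℂ n d M) (pencilMap n d M f₀ g) c₀) k).symm) ∈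
        ratMonodromyGroup (familyPullback.snd (familyM ℂ n d M) (pencilMap n d M f₀ g)) k hU' ⟨c₀, mem_univ _⟩ :=
  exists_finiteIndex_conj_mem_ratMonodromyGroup_familyPullback (familyM ℂ n d M) (pencilMap n d M f₀ g) k hU hU' c₀
    (fun γ => exists_loop_lift_pencilMap χ hχ hg c₀ hQ γ)

end Lift

end MonomialPencil

end Literature.AlgebraicGeometry.HodgeTheory

end
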